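import Literature.NumberTheory.EllipticCurves.NodalCubicFormalGroupProofs
import Literature.NumberTheory.EllipticCurves.FormalGroupFrobeniusTypeProofs
import Literature.NumberTheory.EllipticCurves.PadicSigmaVariableChangeProofs
import Literature.NumberTheory.EllipticCurves.SingularCubicMapProofs
import HarnessLib

/-!
# Honda's congruences for `log_E` at a prime of multiplicative reduction: `log_E` is of Honda
# type `p − εT`, `ε = ±1` the splitting sign of the node (Honda 1968, Thm. 5; 1970, Thm. 9) — proofs

Topic `NumberTheory/EllipticCurves` (theorems only; no definition, no named fact). Let `V` be a
Weierstrass equation over `ℤ_p` with generic fibre `W = V ⊗ ℚ_p` (ellipticity is never used) whose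
special fibre `Ṽ = V ⊗ 𝔽_p` is a NODAL cubic (`Δ̃ = 0`, `c̃₄ ≠ 0`: multiplicative reduction).
The node of `Ṽ` is `𝔽_p`-rational (`exists_singular_point_zmod`: it is unique over `𝔽̄_p`, hence
Frobenius-fixed), so after the `ℤ_p`-integral translation `(x, y) ↦ (x + r, y + t)` moving it to
the origin the reduction is an origin-nodal cubic (`ã₃ = ã₄ = ã₆ = 0`, `b̃₂ ≠ 0`), whose formal
multiplication by `p` is `Xᵖ` or `ĩ(Xᵖ)` according as the tangent slopes at the node are
rational or not (`NodalCubicFormalGroupProofs`). Lifting to `ℤ_p`: `[p]_V ≡ [ε]_V(Xᵖ) (mod p)`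
with `ε = 1` (split node) or `ε = −1` (non-split node), and reading this through `log_W`
(`log_W(u) ≡ log_W(v) (mod p)` for `p`-integral `u ≡ v`, the tree's
`norm_coeff_subst_sub_subst_le_of_natCast_mul_coeff_le`) gives the one-term congruence

  `p·log_W(X) − ε·log_W(Xᵖ) ∈ p ℤ_p⟦X⟧`,   i.e. `log_W` is of Honda type `p − εT`.

Since `(1 − εT)(p − εT) = p − ε(1+p)T + T²` with `1 − εT` a unit of `ℤ_p⟦T⟧`, the one-term type
`p − εT` IS the two-term type `p − ε(1+p)T + T²` of the tree's `hondaShift`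
(`norm_coeff_hondaShift_le_one_of_oneTerm`), so the conclusion is stated as
**`hondaShift p (ε(1+p)) log_W ∈ ℤ_p⟦X⟧`** — `norm_coeff_hondaShift_formalLog_le_one_of_nodal_split`
(`a = 1 + p`, when the node-tangent quadratic `c₄T² + a₁c₄T − (54b₆ − 3b₂b₄ + a₂c₄)` of `Ṽ`, the
one of Mathlib's `HasSplitMultiplicativeReduction`, splits over `𝔽_p`) and
`norm_coeff_hondaShift_formalLog_le_one_of_nodal_nonsplit` (`a = −(1 + p)`, when it does not) —
and all of the tree's two-term functional-equation machinery (`HondaTypeTransport`,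
`HondaTypeFunctionalEquationII`) applies verbatim. This is the "elliptic side" at a multiplicative
prime of Honda's theorem that the formal group of `E/ℚ` is strongly isomorphic over `ℤ` to that
of `L(E, s)` (Honda 1968, Thm. 5: at `p ∥ N` the type is `p − ε_pT` with the Euler factor
`(1 − ε_p p⁻ˢ)⁻¹`; Honda 1970, Thm. 9), obtained here WITHOUT Tate's `p`-adic uniformisation: the
input is the conjugation of the formal group of a nodal cubic onto `𝔾̂_m` by `(1 + αz)/(1 + βz)`.

## References

* T. Honda, *Formal groups and zeta-functions*, Osaka J. Math. 5 (1968), 199–213, Thm. 5.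
* T. Honda, *On the theory of commutative formal groups*, J. Math. Soc. Japan 22 (1970),
  213–246, §2 (types), §6.2, Thm. 9 (held: `paper:doi-10-2969-jmsj-02220213`). [Honda1970]
* J. H. Silverman, *The Arithmetic of Elliptic Curves*, 2nd ed. (2009): proof of
  Prop. III.1.4(a), Prop. III.2.5, VII.5 (multiplicative reduction: the node and its tangent
  slopes). [SilvermanAEC2009]
* M. Hazewinkel, *Formal Groups and Applications* (1978), Ch. I §2 (functional equation lemma).
  [Hazewinkel1978]
-/

noncomputable section

open scoped Classical

namespace WeierstrassCurve

open PowerSeries Literature.NumberTheory.EllipticCurves Literature.RingTheory.FormalGroups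

/-! ### The node of a singular cubic over `𝔽_p` is rational -/

section RationalNode

variable {p : ℕ} [hp : Fact p.Prime]

/-- **The singular point of a singular Weierstrass cubic over `𝔽_p` is `𝔽_p`-rational.** Over
`𝔽̄_p` there is a singular point (`exists_singularPoint`), it is unique
(`singularModel.eq_of_equation_of_not_nonsingular` with `eq_singularModel`), and Frobenius permutes the
singular points of a curve defined over `𝔽_p`; so it is Frobenius-fixed, i.e. rational.
[Silverman AEC, proof of Prop. III.1.4(a); VII.5 (the node of the reduction)] [folklore] -/
theorem exists_singular_point_zmod (E : WeierstrassCurve (ZMod p)) (hΔ : E.Δ = 0) :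
    ∃ x₀ y₀ : ZMod p, E.toAffine.Equation x₀ y₀ ∧ ¬ E.toAffine.Nonsingular x₀ y₀ := by
  set k := AlgebraicClosure (ZMod p) with hk
  set ι : ZMod p →+* k := algebraMap (ZMod p) k with hι
  haveI : ExpChar k p := ExpChar.prime hp.out
  set V := E.map ι with hV
  have hΔ' : V.Δ = 0 := by rw [hV, map_Δ, hΔ, map_zero]
  obtain ⟨x₀, y₀, hE, hX, hY⟩ := V.exists_singularPoint hΔ'
  obtain ⟨α₁, α₂, hs, hpr⟩ := V.exists_tangentSlopes x₀
  have hVs : V = singularModel x₀ y₀ α₁ α₂ := V.eq_singularModel hE hX hY hs hpr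
  have hS : ¬ V.toAffine.Nonsingular x₀ y₀ := by rw [hVs]; exact singularModel.not_nonsingular_S _ _ _ _
  -- Frobenius fixes the (unique) singular point
  set F : k →+* k := frobenius k p with hF
  have hFι : F.comp ι = ι := Subsingleton.elim _ _
  have hVF : V.map F = V := by rw [hV, map_map, hFι]
  have hEF : V.toAffine.Equation (F x₀) (F y₀) := by
    have h := (Affine.map_equation (W := V) F.injective x₀ y₀).mpr hE
    change (V.map F).toAffine.Equation (F x₀) (F y₀) at h
    rwa [hVF] at h
  have hSF : ¬ V.toAffine.Nonsingular (F x₀) (F y₀) := by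
    intro h
    have h' : (V.map F).toAffine.Nonsingular (F x₀) (F y₀) := by rwa [hVF]
    exact hS ((Affine.map_nonsingular (W := V) F.injective x₀ y₀).mp h')
  rw [hVs] at hEF hSF
  obtain ⟨hx, hy⟩ := singularModel.eq_of_equation_of_not_nonsingular hEF hSF
  rw [hF, frobenius_def] at hx hy
  obtain ⟨m, hm⟩ := exists_algebraMap_eq_of_pow_eq hx
  obtain ⟨n, hn⟩ := exists_algebraMap_eq_of_pow_eq hy
  rw [← hι] at hm hn
  refine ⟨m, n, (Affine.map_equation (W := E) ι.injective m n).mp ?_, fun h ↦ hS ?_⟩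
  · change (E.map ι).toAffine.Equation (ι m) (ι n)
    rw [hm, hn, ← hV]; exact hE
  · have h' : (E.map ι).toAffine.Nonsingular (ι m) (ι n) :=
      (Affine.map_nonsingular (W := E) ι.injective m n).mpr h
    rwa [hm, hn, ← hV] at h'

end RationalNode

/-! ### One-term Honda types `p − εT` are two-term types `p − ε(1+p)T + T²` -/

section OneTerm

variable {p : ℕ} [hp : Fact p.Prime]

/-- **Type `p − εT` ⇒ type `p − ε(1+p)T + T²`** (`ε = ±1`; `(1 − εT)·(p − εT) = p − ε(1+p)T + T²`):
if `s = p·ℓ − ε·ℓ(Xᵖ)` has all coefficients of norm `≤ p⁻¹` then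
`hondaShift p (ε(1+p)) ℓ = p⁻¹·(s − ε s(Xᵖ))` is `p`-integral. [Honda 1970, §2 (equivalence of
types under left units)] [cite: Honda1970, Thm. 2 (p. 223)] -/
theorem norm_coeff_hondaShift_le_one_of_oneTerm {ε : ℤ} (hε : ε = 1 ∨ ε = -1) {ℓ : ℚ_[p]⟦X⟧}
    (hs : ∀ n, ‖coeff n (C (p : ℚ_[p]) * ℓ - C (ε : ℚ_[p]) * expand p (prime_ne_zero p) ℓ)‖ ≤ (p : ℝ)⁻¹)
    (n : ℕ) : ‖coeff n (hondaShift p ((ε * (1 + p) : ℤ) : ℚ_[p]) ℓ)‖ ≤ 1 := by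
  have hp0 : p ≠ 0 := hp.out.ne_zero
  have hCε : C (ε : ℚ_[p]) * C (ε : ℚ_[p]) = (1 : ℚ_[p]⟦X⟧) := by
    rw [← map_mul, ← Int.cast_mul, ← map_one C, ← Int.cast_one (R := ℚ_[p])]
    rcases hε with rfl | rfl <;> norm_num
  set s : ℚ_[p]⟦X⟧ := C (p : ℚ_[p]) * ℓ - C (ε : ℚ_[p]) * expand p (prime_ne_zero p) ℓ with hsdef
  have key : hondaShift p ((ε * (1 + p) : ℤ) : ℚ_[p]) ℓ =
      C ((p : ℚ_[p])⁻¹) * (s - C (ε : ℚ_[p]) * expand p (prime_ne_zero p) s) := by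
    rw [hondaShift_eq_C_mul]
    congr 1
    rw [hsdef, map_sub, map_mul, map_mul, expand_C, expand_C, expand_expand,
      expand_congr (sq p).symm (Nat.mul_ne_zero hp0 hp0) (prime_sq_ne_zero p), nsmul_eq_mul,
      smul_eq_C_mul, map_natCast]
    push_cast
    rw [map_mul, map_add, map_one, map_natCast]
    linear_combination (-(expand (p ^ 2) (prime_sq_ne_zero p) ℓ)) * hCε
  rw [key, coeff_C_mul, norm_mul, norm_inv, Padic.norm_p, inv_inv]
  have hε1 : ‖(ε : ℚ_[p])‖ ≤ 1 := Padic.norm_int_le_one _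
  have hpr : (0 : ℝ) ≤ (p : ℝ)⁻¹ := by positivity
  have h2 : ‖coeff n (s - C (ε : ℚ_[p]) * expand p (prime_ne_zero p) s)‖ ≤ (p : ℝ)⁻¹ := by
    refine norm_coeff_sub_le hs (fun m ↦ ?_) n
    rw [coeff_C_mul, norm_mul]
    calc ‖(ε : ℚ_[p])‖ * ‖coeff m (expand p (prime_ne_zero p) s)‖ ≤ 1 * (p : ℝ)⁻¹ :=
          mul_le_mul hε1 (norm_coeff_expand_le _ hpr hs m) (norm_nonneg _) zero_le_one
      _ = (p : ℝ)⁻¹ := one_mul _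
  have hp' : (0 : ℝ) < p := by exact_mod_cast hp.out.pos
  calc (p : ℝ) * ‖coeff n (s - C (ε : ℚ_[p]) * expand p (prime_ne_zero p) s)‖ ≤ p * (p : ℝ)⁻¹ :=
        mul_le_mul_of_nonneg_left h2 hp'.le
    _ = 1 := mul_inv_cancel₀ hp'.ne'

end OneTerm

/-! ### Lifting `[p]˜ = [ε]˜(Xᵖ)` to `ℤ_p` and reading it through `log_W` -/

section Lift

variable {p : ℕ} [hp : Fact p.Prime] (V : WeierstrassCurve ℤ_[p])

/-- **From `[p]˜ ≡ [ε]˜(Xᵖ) (mod p)` to the type `p − εT` of `log_W`.** Let `V/ℤ_p` have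
generic fibre `W`, `ε = ±1`, and suppose the multiplication-by-`p` series reduces mod `p` to `Xᵖ`
(`ε = 1`) resp. to `ĩ(Xᵖ)` (`ε = −1`). Then `p·log_W − ε·log_W(Xᵖ) ≡ 0 (mod p)` coefficientwise,
hence `hondaShift p (ε(1+p)) log_W ∈ ℤ_p⟦X⟧`. (`log_W([p]) = p·log_W`, `log_W(ĩ(u)) = −log_W(u)`,
and `log_W(u) ≡ log_W(v) (mod p)` for `p`-integral `u ≡ v (mod p)`.) [Honda 1970, §6.2 (proof of
Thm. 9)] [cite: Honda1970, Thm. 9 (pp. 240–241)] -/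
theorem norm_coeff_hondaShift_formalLog_le_one_of_formalMul_prime_congr {ε : ℤ} (hε : ε = 1 ∨ ε = -1)
    (hV : PowerSeries.map PadicInt.toZMod (V.formalMul p -
      (if ε = 1 then (X : ℤ_[p]⟦X⟧) ^ p else V.formalNeg.subst ((X : ℤ_[p]⟦X⟧) ^ p))) = 0) (n : ℕ) :
    ‖coeff n (hondaShift p ((ε * (1 + p) : ℤ) : ℚ_[p]) (V.map PadicInt.Coe.ringHom).formalLog)‖ ≤ 1 := by
  haveI := V.isIntegral_map_coe
  set W := V.map PadicInt.Coe.ringHom with hWdef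
  have hp0 : p ≠ 0 := hp.out.ne_zero
  set Rz : ℤ_[p]⟦X⟧ := if ε = 1 then (X : ℤ_[p]⟦X⟧) ^ p else V.formalNeg.subst ((X : ℤ_[p]⟦X⟧) ^ p)
    with hRz
  -- the two `ℚ_p`-series `u = [p]_W`, `v = Xᵖ` resp. `i_W(Xᵖ)`
  set u : ℚ_[p]⟦X⟧ := (V.formalMul p).map PadicInt.Coe.ringHom with hu
  set v : ℚ_[p]⟦X⟧ := Rz.map PadicInt.Coe.ringHom with hv
  have hXp0 : constantCoeff ((X : ℚ_[p]⟦X⟧) ^ p) = 0 := by rw [map_pow, constantCoeff_X, zero_pow hp0]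
  have hXs : HasSubst ((X : ℚ_[p]⟦X⟧) ^ p) := HasSubst.X_pow hp0
  have hu' : u = W.formalMul p := by rw [hu, map_formalMul]
  have hv' : v = if ε = 1 then (X : ℚ_[p]⟦X⟧) ^ p else W.formalNeg.subst ((X : ℚ_[p]⟦X⟧) ^ p) := by
    rw [hv, hRz]
    split_ifs
    · rw [map_pow, PowerSeries.map_X]
    · rw [powerSeries_map_subst _ (HasSubst.X_pow hp0), map_formalNeg, map_pow, PowerSeries.map_X]
  have huv : ∀ n, ‖coeff n (u - v)‖ ≤ (p : ℝ)⁻¹ := fun n ↦ by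
    rw [hu, hv, ← map_sub]
    exact norm_coeff_map_le_inv_of_map_toZMod hV n
  have hint : ∀ (f : ℤ_[p]⟦X⟧) (n : ℕ), ‖coeff n (f.map (PadicInt.Coe.ringHom (p := p)))‖ ≤ 1 :=
    fun f n ↦ by rw [coeff_map]; exact PadicInt.norm_le_one _
  have hu0 : constantCoeff u = 0 := by rw [hu', W.constantCoeff_formalMul]
  have hv0 : constantCoeff v = 0 := by
    rw [hv']
    split_ifs
    · exact hXp0
    · rw [constantCoeff_subst_eq_constantCoeff hXp0, constantCoeff_formalNeg]
  have key := norm_coeff_subst_sub_subst_le_of_natCast_mul_coeff_le (W.norm_natCast_mul_coeff_formalLog_le)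
    hu0 (hint _) hv0 (hint _) huv
  -- the logarithms: `log_W(u) − log_W(v) = p log_W − ε log_W(Xᵖ)`
  have hlog : W.formalLog.subst u - W.formalLog.subst v =
      C (p : ℚ_[p]) * W.formalLog - C (ε : ℚ_[p]) * expand p (prime_ne_zero p) W.formalLog := by
    rw [hu', W.formalLog_subst_formalMul_rat p, hv', nsmul_eq_mul, map_natCast]
    split_ifs with h1
    · rw [h1, Int.cast_one, map_one, one_mul, expand_apply]
    · have hm1 : ε = -1 := hε.resolve_left h1
      rw [hm1, ← subst_comp_subst_apply (HasSubst.of_constantCoeff_zero' W.constantCoeff_formalNeg) hXs,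
        W.formalLog_subst_formalNeg, ← coe_substAlgHom hXs, map_neg, coe_substAlgHom,
        ← expand_apply p (prime_ne_zero p),
        Int.cast_neg, Int.cast_one, map_neg, map_one, neg_mul, one_mul, sub_neg_eq_add]
  refine norm_coeff_hondaShift_le_one_of_oneTerm hε (fun m ↦ ?_) n
  rw [← hlog]
  exact key m

end Lift

/-! ### The translation of the node to the origin and the main theorems -/

section Nodal

variable {p : ℕ} [hp : Fact p.Prime] (V : WeierstrassCurve ℤ_[p])

/-- **Moving the node to the origin over `ℤ_p`.** If `Ṽ = V ⊗ 𝔽_p` is singular, there are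
`r, t ∈ ℤ_p` (lifts of the coordinates of its rational singular point) such that the translated
equation `V₁ = (1, r, 0, t) • V` reduces to a cubic with `ã₃ = ã₄ = ã₆ = 0` (singular point at
the origin: Mathlib's `equation_iff_variableChange` / `nonsingular_iff_variableChange`).
[Silverman AEC, proof of III.1.4(a)] [folklore] -/
theorem exists_variableChange_reduction_origin_singular (hΔ : (V.map PadicInt.toZMod).Δ = 0) :
    ∃ r t : ℤ_[p], ((⟨1, r, 0, t⟩ : VariableChange ℤ_[p]) • V).map PadicInt.toZMod =
        (⟨1, PadicInt.toZMod r, 0, PadicInt.toZMod t⟩ : VariableChange (ZMod p)) • V.map PadicInt.toZMod ∧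
      (((⟨1, r, 0, t⟩ : VariableChange ℤ_[p]) • V).map PadicInt.toZMod).a₃ = 0 ∧
      (((⟨1, r, 0, t⟩ : VariableChange ℤ_[p]) • V).map PadicInt.toZMod).a₄ = 0 ∧
      (((⟨1, r, 0, t⟩ : VariableChange ℤ_[p]) • V).map PadicInt.toZMod).a₆ = 0 := by
  set E := V.map PadicInt.toZMod with hEdef
  obtain ⟨x₀, y₀, hEq, hS⟩ := E.exists_singular_point_zmod hΔ
  refine ⟨(x₀.val : ℤ_[p]), (y₀.val : ℤ_[p]), ?_⟩
  have hr : PadicInt.toZMod ((x₀.val : ℕ) : ℤ_[p]) = x₀ := by rw [map_natCast, ZMod.natCast_zmod_val]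
  have ht : PadicInt.toZMod ((y₀.val : ℕ) : ℤ_[p]) = y₀ := by rw [map_natCast, ZMod.natCast_zmod_val]
  have hmap : ((⟨1, (x₀.val : ℤ_[p]), 0, (y₀.val : ℤ_[p])⟩ : VariableChange ℤ_[p]) • V).map PadicInt.toZMod =
      (⟨1, x₀, 0, y₀⟩ : VariableChange (ZMod p)) • E := by
    rw [← map_variableChange, hEdef]
    congr 1
    simp [VariableChange.map]
  rw [hr, ht, hmap]
  have h6 : ((⟨1, x₀, 0, y₀⟩ : VariableChange (ZMod p)) • E).a₆ = 0 :=
    (Affine.equation_zero).mp ((Affine.equation_iff_variableChange x₀ y₀).mp hEq)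
  have h34 : ¬ (((⟨1, x₀, 0, y₀⟩ : VariableChange (ZMod p)) • E).a₃ ≠ 0 ∨
      ((⟨1, x₀, 0, y₀⟩ : VariableChange (ZMod p)) • E).a₄ ≠ 0) := by
    intro h
    exact hS ((Affine.nonsingular_iff_variableChange x₀ y₀).mpr (Affine.nonsingular_zero.mpr ⟨h6, h⟩))
  rw [not_or, not_ne_iff, not_ne_iff] at h34
  exact ⟨rfl, h34.1, h34.2, h6⟩

/-- For a cubic with `a₃ = a₄ = a₆ = 0`, Mathlib's node-tangent polynomial
`c₄T² + a₁c₄T − (54b₆ − 3b₂b₄ + a₂c₄)` is `c₄·(T² + a₁T − a₂)` (`b₄ = b₆ = 0`). [folklore] -/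
theorem nodalTangents_eq_of_origin {S : Type*} [CommRing S] (E : WeierstrassCurve S) (h₃ : E.a₃ = 0)
    (h₄ : E.a₄ = 0) (h₆ : E.a₆ = 0) :
    Polynomial.C E.c₄ * Polynomial.X ^ 2 + Polynomial.C (E.a₁ * E.c₄) * Polynomial.X
        - Polynomial.C (54 * E.b₆ - 3 * E.b₂ * E.b₄ + E.a₂ * E.c₄) =
      Polynomial.C E.c₄ * (Polynomial.C 1 * Polynomial.X ^ 2 + Polynomial.C E.a₁ * Polynomial.X +
        Polynomial.C (-E.a₂)) := by
  have hb₄ : E.b₄ = 0 := by rw [b₄, h₃, h₄]; ring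
  have hb₆ : E.b₆ = 0 := by rw [b₆, h₃, h₆]; ring
  rw [hb₄, hb₆]
  simp only [mul_zero, sub_zero, zero_add, map_mul, map_neg, map_one]
  ring

/-- For a cubic with `a₃ = a₄ = a₆ = 0`, `c₄ = b₂²`. [folklore] -/
theorem c₄_eq_b₂_sq_of_origin {S : Type*} [CommRing S] (E : WeierstrassCurve S) (h₃ : E.a₃ = 0)
    (h₄ : E.a₄ = 0) : E.c₄ = E.b₂ ^ 2 := by
  have hb₄ : E.b₄ = 0 := by rw [b₄, h₃, h₄]; ring
  rw [c₄, hb₄, mul_zero, sub_zero]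

/-- The common part of the two main theorems: translate the node to the origin over `ℤ_p`, get the
sign from the tangent quadratic, apply `[p]˜ = Xᵖ` / `ĩ(Xᵖ)`, lift, and transport the type back
along the (integral, `u = 1`) translation. [cite: Honda1970, Thm. 9 (pp. 240–241)] -/
theorem norm_coeff_hondaShift_formalLog_le_one_of_nodal_aux (hΔ : (V.map PadicInt.toZMod).Δ = 0)
    (hc₄ : (V.map PadicInt.toZMod).c₄ ≠ 0) {ε : ℤ} (hε : ε = 1 ∨ ε = -1)
    (hεQ : letI E := V.map PadicInt.toZMod
      (Polynomial.C E.c₄ * Polynomial.X ^ 2 + Polynomial.C (E.a₁ * E.c₄) * Polynomial.X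
        - Polynomial.C (54 * E.b₆ - 3 * E.b₂ * E.b₄ + E.a₂ * E.c₄)).Splits ↔ ε = 1) (n : ℕ) :
    ‖coeff n (hondaShift p ((ε * (1 + p) : ℤ) : ℚ_[p]) (V.map PadicInt.Coe.ringHom).formalLog)‖ ≤ 1 := by
  have hp0 : p ≠ 0 := hp.out.ne_zero
  obtain ⟨r, t, hmap, h₃, h₄, h₆⟩ := V.exists_variableChange_reduction_origin_singular hΔ
  set C₁ : VariableChange ℤ_[p] := ⟨1, r, 0, t⟩ with hC₁
  set V₁ : WeierstrassCurve ℤ_[p] := C₁ • V with hV₁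
  set E := V.map PadicInt.toZMod with hEdef
  set E₁ := V₁.map PadicInt.toZMod with hE₁def
  -- the reduction of `V₁` is origin-nodal with the same tangent quadratic
  have hc₄₁ : E₁.c₄ = E.c₄ := by
    rw [hmap, variableChange_c₄, inv_one, Units.val_one, one_pow, one_mul]
  have hb₂ : E₁.b₂ ≠ 0 := fun h ↦ hc₄ (by
    rw [← hc₄₁, c₄_eq_b₂_sq_of_origin E₁ h₃ h₄, h, zero_pow two_ne_zero])
  have hc₄₁' : E₁.c₄ ≠ 0 := by rwa [hc₄₁]
  have hQ : Polynomial.C E₁.c₄ * Polynomial.X ^ 2 + Polynomial.C (E₁.a₁ * E₁.c₄) * Polynomial.X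
        - Polynomial.C (54 * E₁.b₆ - 3 * E₁.b₂ * E₁.b₄ + E₁.a₂ * E₁.c₄) =
      Polynomial.C E.c₄ * Polynomial.X ^ 2 + Polynomial.C (E.a₁ * E.c₄) * Polynomial.X
        - Polynomial.C (54 * E.b₆ - 3 * E.b₂ * E.b₄ + E.a₂ * E.c₄) := by
    rw [hmap, nodalTangents_variableChange]
    simp
  set q : Polynomial (ZMod p) := Polynomial.C 1 * Polynomial.X ^ 2 + Polynomial.C E₁.a₁ * Polynomial.X +
    Polynomial.C (-E₁.a₂) with hq
  have hq2 : q.degree = 2 := Polynomial.degree_quadratic one_ne_zero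
  have hqeval : ∀ m : ZMod p, q.eval m = m ^ 2 + E₁.a₁ * m - E₁.a₂ := fun m ↦ by
    simp only [hq, Polynomial.eval_add, Polynomial.eval_mul, Polynomial.eval_C, Polynomial.eval_pow,
      Polynomial.eval_X, one_mul]
    ring
  have hQq : (Polynomial.C E.c₄ * Polynomial.X ^ 2 + Polynomial.C (E.a₁ * E.c₄) * Polynomial.X
        - Polynomial.C (54 * E.b₆ - 3 * E.b₂ * E.b₄ + E.a₂ * E.c₄)).Splits ↔ q.Splits := by
    rw [← hQ, nodalTangents_eq_of_origin E₁ h₃ h₄ h₆, ← hq]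
    exact Polynomial.splits_mul_iff_right (Polynomial.C_ne_zero.mpr hc₄₁') (Polynomial.Splits.C _)
  -- `[p]˜ = Xᵖ` resp. `ĩ(Xᵖ)` for `E₁`
  have hcong : PowerSeries.map PadicInt.toZMod (V₁.formalMul p -
      (if ε = 1 then (X : ℤ_[p]⟦X⟧) ^ p else V₁.formalNeg.subst ((X : ℤ_[p]⟦X⟧) ^ p))) = 0 := by
    rw [map_sub, map_formalMul, ← hE₁def, sub_eq_zero]
    rcases hε with h1 | h1
    · rw [if_pos h1, map_pow, PowerSeries.map_X]
      have hsplit : q.Splits := hQq.mp (hεQ.mpr h1)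
      obtain ⟨m, hm⟩ := hsplit.exists_eval_eq_zero (by rw [hq2]; decide)
      exact E₁.formalMul_prime_eq_X_pow_of_nodal_split h₃ h₄ h₆ hb₂ ⟨m, by rw [← hqeval]; exact hm⟩
    · have hne : ε ≠ 1 := by rw [h1]; decide
      rw [if_neg hne, powerSeries_map_subst _ (HasSubst.X_pow hp0), map_formalNeg, ← hE₁def, map_pow,
        PowerSeries.map_X]
      refine E₁.formalMul_prime_eq_formalNeg_subst_of_nodal_nonsplit h₃ h₄ h₆ hb₂ fun m hm ↦ hne ?_
      exact hεQ.mp (hQq.mpr (Polynomial.Splits.of_degree_eq_two hq2 (by rw [hqeval]; exact hm)))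
  -- the generic fibre of `V₁` is `C₁ • W`
  set W := V.map PadicInt.Coe.ringHom with hWdef
  set C' : VariableChange ℚ_[p] := C₁.map PadicInt.Coe.ringHom with hC'
  have hW₁ : V₁.map PadicInt.Coe.ringHom = C' • W := by rw [hV₁, hC', hWdef, map_variableChange]
  have hT₁ := V₁.norm_coeff_hondaShift_formalLog_le_one_of_formalMul_prime_congr hε hcong
  -- transport along `θ = formalVariableChange W C'`: `log_{C' • W}(θ) = log_W`
  haveI := V.isIntegral_map_coe
  have hC'u : C'.u = 1 := by rw [hC', VariableChange.map_u, hC₁]; simp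
  have hlogW : W.formalLog = (V₁.map PadicInt.Coe.ringHom).formalLog.subst (W.formalVariableChange C') := by
    rw [hW₁, formalLog_variableChange_subst, hC'u, Units.val_one, map_one, one_mul]
  have hθ : ∀ m, ‖coeff m (W.formalVariableChange C')‖ ≤ 1 := by
    refine isPadicInt_iff_coeff.mp (W.isPadicInt_formalVariableChange C' ?_ ?_ ?_ ?_)
    · rw [hC'u, Units.val_one, norm_one]
    · rw [hC', VariableChange.map_r]; exact PadicInt.norm_le_one _
    · rw [hC', VariableChange.map_s, hC₁]; simp
    · rw [hC', VariableChange.map_t]; exact PadicInt.norm_le_one _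
  rw [hlogW]
  exact norm_coeff_hondaShift_subst_le_one (Padic.norm_int_le_one _) hT₁
    (W.constantCoeff_formalVariableChange C') hθ n

/-- **Honda's congruences at a SPLIT node: `log_W` is of type `p − T`, i.e.
`hondaShift p (1 + p) log_W ∈ ℤ_p⟦X⟧`.** For `V/ℤ_p` with generic fibre `W` and nodal
reduction `Ṽ` (`Δ̃ = 0`, `c̃₄ ≠ 0`) whose node-tangent polynomial
`c₄T² + a₁c₄T − (54b₆ − 3b₂b₄ + a₂c₄)` splits over `𝔽_p` (split multiplicative reduction).
[Honda 1968, Thm. 5; Honda 1970, Thm. 9 (proof, a place `p ∥ N` with `ε_p = 1`)]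
[cite: Honda1970, Thm. 9 (pp. 240–241)] -/
theorem norm_coeff_hondaShift_formalLog_le_one_of_nodal_split (hΔ : (V.map PadicInt.toZMod).Δ = 0)
    (hc₄ : (V.map PadicInt.toZMod).c₄ ≠ 0)
    (hsplit : letI E := V.map PadicInt.toZMod
      (Polynomial.C E.c₄ * Polynomial.X ^ 2 + Polynomial.C (E.a₁ * E.c₄) * Polynomial.X
        - Polynomial.C (54 * E.b₆ - 3 * E.b₂ * E.b₄ + E.a₂ * E.c₄)).Splits) (n : ℕ) :
    ‖coeff n (hondaShift p ((1 + p : ℕ) : ℚ_[p]) (V.map PadicInt.Coe.ringHom).formalLog)‖ ≤ 1 := by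
  have h := V.norm_coeff_hondaShift_formalLog_le_one_of_nodal_aux hΔ hc₄ (ε := 1) (Or.inl rfl)
    (iff_of_true hsplit rfl) n
  rwa [one_mul, show ((1 + p : ℤ) : ℚ_[p]) = ((1 + p : ℕ) : ℚ_[p]) by push_cast; ring] at h

/-- **Honda's congruences at a NON-SPLIT node: `log_W` is of type `p + T`, i.e.
`hondaShift p (−(1 + p)) log_W ∈ ℤ_p⟦X⟧`** (the node-tangent polynomial of `Ṽ` does not split
over `𝔽_p`: non-split multiplicative reduction, `ε_p = −1`). [Honda 1968, Thm. 5; Honda 1970,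
Thm. 9 (proof)] [cite: Honda1970, Thm. 9 (pp. 240–241)] -/
theorem norm_coeff_hondaShift_formalLog_le_one_of_nodal_nonsplit (hΔ : (V.map PadicInt.toZMod).Δ = 0)
    (hc₄ : (V.map PadicInt.toZMod).c₄ ≠ 0)
    (hns : letI E := V.map PadicInt.toZMod
      ¬ (Polynomial.C E.c₄ * Polynomial.X ^ 2 + Polynomial.C (E.a₁ * E.c₄) * Polynomial.X
        - Polynomial.C (54 * E.b₆ - 3 * E.b₂ * E.b₄ + E.a₂ * E.c₄)).Splits) (n : ℕ) :
    ‖coeff n (hondaShift p (-((1 + p : ℕ) : ℚ_[p])) (V.map PadicInt.Coe.ringHom).formalLog)‖ ≤ 1 := by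
  have h := V.norm_coeff_hondaShift_formalLog_le_one_of_nodal_aux hΔ hc₄ (ε := -1) (Or.inr rfl)
    (iff_of_false hns (by decide)) n
  rwa [neg_one_mul, show ((-(1 + p : ℤ) : ℤ) : ℚ_[p]) = -((1 + p : ℕ) : ℚ_[p]) by push_cast; ring] at h

end Nodal

end WeierstrassCurve
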